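import Literature.Analysis.FluidPDE.TypeIRateScaledEnergyBoundUniform
import Literature.Analysis.FluidPDE.SpaceTimeRescaling
import Literature.Analysis.FluidPDE.SuitableWeakRescaling
import Literature.Analysis.FluidPDE.SereginSverakPressureProofs
import Literature.Analysis.FluidPDE.ClassicalSuitable
import Summits.NavierStokesRegularity.NavierStokesRegularity.Theorems.StretchingWellBindingEnstrophyQuarterLawLocalTypeITools
import HarnessLib

/-!
# The sup-norm Type-I rate forces UNIFORM LOCAL TYPE I (CKN `A`- and `E`-currencies) near the
# blow-up time — late-time core

Helper file (`--supports stmt-NavierStokesRegularity-23726`; crux `QuarterLawTypeI`, line `lorentz-upgrade`: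
the uniform scale-`r₀` local energy bound is the standing hypothesis of the tree's localized smoothing
theorem `EnstrophyQuarterLaw.SparseSieve.stub_smoothingEnvelope`, the engine foreseen for the open stub
`stub_lorentzCount` = `LorentzCountTypeI`, stmt-24109; it is also stub S1 `UniformLocalTypeI` of the
1574 shelf's line `sparse_sieve` on the Type-I stratum).

`late_scaledBounds_of_isTypeIBlowup`: for a classical solution on `[0,T)` (viscosity `ν`), Leray–Hopf on
`[0,T]`, with `‖u(t,x)‖ ≤ C/√(T−t)` near `T`, there are `M, r₀ > 0` and `t⋆ < T` with
(A) `∫_{B(x,R)} |u(s)|² ≤ M R` for `s ∈ [t⋆, T)`, all `x`, `0 < R ≤ r₀`, and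
(E) `∫∫_{(b−R², b) × B(x,R)} |∇u|_F² ≤ M R` for `b ∈ (t⋆, T]`, all `x`, `0 < R ≤ r₀`.

PROOF (the frame of `EnstrophyQuarterLaw.LocalTypeI.energy_ball_le_of_window`, with Seregin's `E`-Morrey
estimate replaced by the Type-I one): unit-viscosity rescaling `v(s,y) = ν⁻¹u(ν⁻¹s,y)` with Tao's pressure
gauge; on every cylinder `Q_{r₁}(τ, x)` with apex `ν t_I + r₁² ≤ τ ≤ νT` the rate `√(τ−s)|v| ≤ c` holds
a.e., the top-scale `C(r₁)`, `D(r₁)` are bounded by the slab integrals `∫∫|u|³`, `∫∫|q|^{3/2}` uniformly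
in the apex, so Seregin 2014 Prop. 3.11 (i) with printed constant dependence
(`scaledEnergies_bounded_of_typeIRate_unif`) bounds `A + E + C + D ≤ K` on `Q_r(τ,x)`, `r < r₁/2`;
(A) un-zooms the `A`-bound at the apex `min(νT, νs + R²/2)` and passes from a.e. to every time by
continuity (`setLIntegral_ball_sq_le_of_ae`); (E) un-zooms the `E`-bound at the apex `νb`, radius
`R·max(1,√ν)`.

HONEST FRAMING: known mathematics (Seregin–Šverák 2009 L. 3.5 / Seregin 2014 Prop. 3.11 (i)) along ONE
hypothetical Type-I blow-up; nothing about Navier–Stokes regularity or blow-up is claimed.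
[cite: Seregin2014, Ch. 6 §6.3 Prop. 3.11 (i)] [cite: SereginSverak2009, Lemma 3.5]
-/

noncomputable section

-- the summit-side namespace repeats a component by design (D-0017)
set_option linter.dupNamespace false

namespace Summit.NavierStokesRegularity.NavierStokesRegularity.Theorems.CountQuarterLaw

open Set MeasureTheory Function Metric Filter Topology
open scoped ENNReal NNReal
open Literature.Analysis.FluidPDE EnstrophyQuarterLaw.LocalTypeI

variable {ν T : ℝ} {u : ℝ → EuclideanSpace ℝ (Fin 3) → EuclideanSpace ℝ (Fin 3)}
  {p : ℝ → EuclideanSpace ℝ (Fin 3) → ℝ}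

/-- **Type-I rate ⇒ late uniform local Type I (`A` and `E`).** See the module docstring.
[cite: Seregin2014, Ch. 6 §6.3 Prop. 3.11 (i)] [cite: SereginSverak2009, Lemma 3.5] -/
theorem late_scaledBounds_of_isTypeIBlowup (hν : 0 < ν) (hT : 0 < T)
    (hsol : IsClassicalNSSolutionOn (Ico 0 T) ν 0 u p) (hLH : IsLerayHopfOn T ν 0 (u 0) u)
    (hI : IsTypeIBlowup u T) :
    ∃ M r₀ tstar : ℝ, 0 < M ∧ 0 < r₀ ∧ tstar < T ∧ 0 ≤ tstar ∧
      (∀ s ∈ Ico tstar T, ∀ (x : EuclideanSpace ℝ (Fin 3)), ∀ R ∈ Ioc 0 r₀,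
        ∫⁻ y in ball x R, ‖u s y‖ₑ ^ 2 ≤ ENNReal.ofReal (M * R)) ∧
      (∀ b ∈ Ioc tstar T, ∀ (x : EuclideanSpace ℝ (Fin 3)), ∀ R ∈ Ioc 0 r₀,
        ∫⁻ w in Ioo (b - R ^ 2) b ×ˢ ball x R, ENNReal.ofReal (frobeniusNormSq (fderiv ℝ (u w.1) w.2)) ≤
          ENNReal.ofReal (M * R)) := by
  -- ### the unit-viscosity rescaling `v = α • stPull α 1 0 0 u`, `α = ν⁻¹`
  set α : ℝ := ν⁻¹ with hα
  have hαpos : 0 < α := inv_pos.2 hν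
  have hαν : α * ν = 1 := by rw [hα, inv_mul_cancel₀ hν.ne']
  have hνα : ν * α = 1 := by rw [mul_comm, hαν]
  have hβeq : α = α * 1 := (mul_one α).symm
  set Sl : TopologicalSpace.Opens (ℝ × EuclideanSpace ℝ (Fin 3)) :=
    ⟨Ioo 0 T ×ˢ univ, isOpen_Ioo.prod isOpen_univ⟩ with hSldef
  have hSlsub : (Sl : Set (ℝ × EuclideanSpace ℝ (Fin 3))) ⊆ Ioo 0 T ×ˢ univ := Subset.rfl
  set q : ℝ → EuclideanSpace ℝ (Fin 3) → ℝ := fun t x => p t x - (p t 0 - normalisedPressure (u t) 0)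
    with hq
  have hsw : IsSuitableWeakSolutionOn (stPreimage α 1 0 0 Sl) 1 0 (α • stPull α 1 0 0 u)
      (α ^ 2 • stPull α 1 0 0 q) := by
    have h0 := (SereginSverak2002.isSuitableWeakSolutionOn_gauge_of_classical hν hT hsol hLH Sl
      hSlsub).stRescale hαpos one_pos hβeq 0 0
    have hvisc : α * ν / 1 = 1 := by rw [div_one, hαν]
    have hforce : ((α ^ 2 * 1) • stPull α 1 0 0 (0 : ℝ → EuclideanSpace ℝ (Fin 3) →
        EuclideanSpace ℝ (Fin 3))) = 0 := by
      funext s y; simp [stPull]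
    rw [hvisc, hforce] at h0
    exact h0
  have hGv : HasWeakSpatialGradientOn (stPreimage α 1 0 0 Sl) (α • stPull α 1 0 0 u)
      ((α * 1) • stPull α 1 0 0 fun t x => fderiv ℝ (u t) x) :=
    (hasWeakSpatialGradientOn_of_contDiffOn isOpen_Ioo hSlsub
      ((SereginSverak2002.classical_Ioo hsol).smooth_velocity.of_le (by norm_cast))).stRescale
      α hαpos one_pos 0 0
  -- cylinders `Q_ρ(τ, x)` with `ρ² ≤ τ ≤ ν T` lie in the rescaled slab
  have hcyl : ∀ (τ ρ : ℝ) (x : EuclideanSpace ℝ (Fin 3)), ρ ^ 2 ≤ τ → τ ≤ ν * T →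
      parabolicCylinder ρ ((τ, x) : ℝ × EuclideanSpace ℝ (Fin 3)) ⊆
        ((stPreimage α 1 0 0 Sl : TopologicalSpace.Opens (ℝ × EuclideanSpace ℝ (Fin 3))) :
          Set (ℝ × EuclideanSpace ℝ (Fin 3))) := by
    intro τ ρ x hρτ hτT w hw
    rw [mem_parabolicCylinder] at hw
    change stAffine α 1 0 0 w ∈ Ioo 0 T ×ˢ (univ : Set (EuclideanSpace ℝ (Fin 3)))
    rw [mem_prod, stAffine_fst]
    have hw1 : 0 < w.1 := by nlinarith [hw.1.1, sq_nonneg ρ]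
    have hw2 : α * w.1 < α * (ν * T) := mul_lt_mul_of_pos_left (lt_of_lt_of_le hw.1.2 hτT) hαpos
    have e : α * (ν * T) = T := by rw [← mul_assoc, hαν, one_mul]
    refine ⟨⟨by nlinarith [mul_pos hαpos hw1], by linarith⟩, mem_univ _⟩
  have hανT : α * (ν * T) = T := by rw [← mul_assoc, hαν, one_mul]
  have hpre : ∀ (τ r : ℝ) (x : EuclideanSpace ℝ (Fin 3)),
      stAffine α 1 0 0 ⁻¹' (Ioo (α * (τ - r ^ 2)) (α * τ) ×ˢ ball x r) =
        parabolicCylinder r ((τ, x) : ℝ × EuclideanSpace ℝ (Fin 3)) := by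
    intro τ r x
    ext w
    simp only [mem_preimage, mem_prod, stAffine_fst, stAffine_snd, mem_parabolicCylinder, mem_Ioo,
      mem_ball, zero_add, one_smul]
    constructor
    · rintro ⟨⟨h1, h2⟩, h3⟩
      exact ⟨⟨lt_of_mul_lt_mul_left h1 hαpos.le, lt_of_mul_lt_mul_left h2 hαpos.le⟩, h3⟩
    · rintro ⟨⟨h1, h2⟩, h3⟩
      exact ⟨⟨mul_lt_mul_of_pos_left h1 hαpos, mul_lt_mul_of_pos_left h2 hαpos⟩, h3⟩
  -- ### the Type-I rate on `(tI', T)` with a non-negative constant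
  obtain ⟨CI, hCI⟩ := hI
  obtain ⟨tI, htIT, hIsub⟩ := mem_nhdsLT_iff_exists_Ioo_subset.1 hCI
  set tI' : ℝ := max tI 0 with htI'
  have htI'T : tI' < T := max_lt htIT hT
  have htI'0 : 0 ≤ tI' := le_max_right _ _
  set B : ℝ := max CI 0 with hB
  have hB0 : 0 ≤ B := le_max_right _ _
  have hrate : ∀ s ∈ Ioo tI' T, ∀ y, ‖u s y‖ ≤ B / Real.sqrt (T - s) := fun s hs y =>
    (hIsub ⟨lt_of_le_of_lt (le_max_left _ _) hs.1, hs.2⟩ y).trans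
      (div_le_div_of_nonneg_right (le_max_left _ _) (Real.sqrt_nonneg _))
  -- ### the constants
  have hνTI : 0 < ν * (T - tI') := mul_pos hν (by linarith)
  set r₁ : ℝ := min 1 (Real.sqrt (ν * (T - tI') / 4)) with hr₁
  have hr₁pos : 0 < r₁ := lt_min one_pos (Real.sqrt_pos.2 (by positivity))
  have hr₁sq : r₁ ^ 2 ≤ ν * (T - tI') / 4 := by
    have h1 : r₁ ≤ Real.sqrt (ν * (T - tI') / 4) := min_le_right _ _
    have h2 := pow_le_pow_left₀ hr₁pos.le h1 2
    rwa [Real.sq_sqrt (by positivity)] at h2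
  have hr₁sq' : r₁ ^ 2 ≤ ν * T / 2 := by
    have : ν * (T - tI') ≤ ν * T := by nlinarith [mul_nonneg hν.le htI'0]
    linarith [hr₁sq]
  have hr₁0 : ENNReal.ofReal r₁ ≠ 0 := (ENNReal.ofReal_pos.2 hr₁pos).ne'
  have hI₃top : ∫⁻ w in Ioo 0 T ×ˢ (univ : Set (EuclideanSpace ℝ (Fin 3))), ‖u w.1 w.2‖ₑ ^ (3 : ℕ) < ⊤ :=
    SereginSverak2002.lintegral_slab_enorm_pow_three_lt_top hν hLH
  have hPqtop : ∫⁻ w in Ioo 0 T ×ˢ (univ : Set (EuclideanSpace ℝ (Fin 3))),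
      ‖q w.1 w.2‖ₑ ^ (3 / 2 : ℝ) < ⊤ :=
    SereginSverak2002.lintegral_slab_gauged_pressure_lt_top hν hT hsol hLH
  set C₃ : ℝ≥0∞ := ‖α‖ₑ ^ (3 : ℕ) *
      ENNReal.ofReal (α * (1 : ℝ) ^ Module.finrank ℝ (EuclideanSpace ℝ (Fin 3)))⁻¹ *
      ∫⁻ w in Ioo 0 T ×ˢ (univ : Set (EuclideanSpace ℝ (Fin 3))), ‖u w.1 w.2‖ₑ ^ (3 : ℕ) with hC₃
  set P₃ : ℝ≥0∞ := ‖α ^ 2‖ₑ ^ (3 / 2 : ℝ) *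
      ENNReal.ofReal (α * (1 : ℝ) ^ Module.finrank ℝ (EuclideanSpace ℝ (Fin 3)))⁻¹ *
      ∫⁻ w in Ioo 0 T ×ˢ (univ : Set (EuclideanSpace ℝ (Fin 3))), ‖q w.1 w.2‖ₑ ^ (3 / 2 : ℝ) with hP₃
  set C₀e : ℝ≥0∞ := (ENNReal.ofReal r₁ ^ 2)⁻¹ * C₃ with hC₀e
  set D₀e : ℝ≥0∞ := (ENNReal.ofReal r₁ ^ 2)⁻¹ * P₃ with hD₀e
  have hC₀top : C₀e ≠ ⊤ :=
    ENNReal.mul_ne_top (ENNReal.inv_ne_top.2 (pow_ne_zero _ hr₁0))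
      (ENNReal.mul_ne_top (ENNReal.mul_ne_top (by simp) ENNReal.ofReal_ne_top) hI₃top.ne)
  have hD₀top : D₀e ≠ ⊤ :=
    ENNReal.mul_ne_top (ENNReal.inv_ne_top.2 (pow_ne_zero _ hr₁0))
      (ENNReal.mul_ne_top (ENNReal.mul_ne_top
        (ENNReal.rpow_ne_top_of_nonneg (by norm_num) enorm_ne_top) ENNReal.ofReal_ne_top) hPqtop.ne)
  set c : ℝ := α * Real.sqrt ν * B with hc
  obtain ⟨KS, hKS⟩ := scaledEnergies_bounded_of_typeIRate_unif c C₀e.toNNReal D₀e.toNNReal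
  have hcont : ContinuousOn (uncurry u) (Ico 0 T ×ˢ (univ : Set (EuclideanSpace ℝ (Fin 3)))) :=
    SereginSverak2002.continuousOn_uncurry hsol
  -- ### the uniform bound at every admissible apex `(τ, x)`, `ν tI' + r₁² ≤ τ ≤ ν T`
  have hKz : ∀ (τ : ℝ) (x : EuclideanSpace ℝ (Fin 3)), ν * tI' + r₁ ^ 2 ≤ τ → τ ≤ ν * T →
      ∀ r ∈ Ioo (0 : ℝ) (r₁ / 2),
        cknAEss r ((τ, x) : ℝ × EuclideanSpace ℝ (Fin 3)) (α • stPull α 1 0 0 u) +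
          cknE r (τ, x) ((α * 1) • stPull α 1 0 0 fun t x => fderiv ℝ (u t) x) +
          cknC r (τ, x) (α • stPull α 1 0 0 u) + cknD r (τ, x) (α ^ 2 • stPull α 1 0 0 q) ≤ KS := by
    intro τ x hτI hτT
    have hτ₁ : r₁ ^ 2 ≤ τ := by linarith [mul_nonneg hν.le htI'0]
    have hzsub := hcyl τ r₁ x hτ₁ hτT
    -- top-scale `C(r₁)`, `D(r₁)` by the slab integrals
    have hCtop : cknC r₁ ((τ, x) : ℝ × EuclideanSpace ℝ (Fin 3)) (α • stPull α 1 0 0 u) ≤ C₀e := by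
      unfold cknC
      refine mul_le_mul' le_rfl ?_
      calc ∫⁻ w in parabolicCylinder r₁ ((τ, x) : ℝ × EuclideanSpace ℝ (Fin 3)),
            ‖(α • stPull α 1 0 0 u) w.1 w.2‖ₑ ^ (3 : ℕ)
          ≤ ∫⁻ w in stAffine α 1 0 0 ⁻¹' (Ioo 0 T ×ˢ (univ : Set (EuclideanSpace ℝ (Fin 3)))),
              ‖(α • stPull α 1 0 0 u) w.1 w.2‖ₑ ^ (3 : ℕ) := lintegral_mono_set hzsub
        _ = C₃ := by rw [hC₃, setLIntegral_enorm_pow_stRescale hαpos one_pos 0 0 α u _ 3]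
    have hDtop : cknD r₁ ((τ, x) : ℝ × EuclideanSpace ℝ (Fin 3)) (α ^ 2 • stPull α 1 0 0 q) ≤ D₀e := by
      unfold cknD
      refine mul_le_mul' le_rfl ?_
      calc ∫⁻ w in parabolicCylinder r₁ ((τ, x) : ℝ × EuclideanSpace ℝ (Fin 3)),
            ‖(α ^ 2 • stPull α 1 0 0 q) w.1 w.2‖ₑ ^ (3 / 2 : ℝ)
          ≤ ∫⁻ w in stAffine α 1 0 0 ⁻¹' (Ioo 0 T ×ˢ (univ : Set (EuclideanSpace ℝ (Fin 3)))),
              ‖(α ^ 2 • stPull α 1 0 0 q) w.1 w.2‖ₑ ^ (3 / 2 : ℝ) := lintegral_mono_set hzsub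
        _ = P₃ := by rw [hP₃, setLIntegral_enorm_rpow_stRescale hαpos one_pos 0 0 (α ^ 2) q _ (by norm_num)]
    -- the Type-I rate a.e. on `Q_{r₁}(τ, x)` (relative to the apex `τ ≤ νT`)
    have hrateV : ∀ᵐ w ∂(volume.restrict (parabolicCylinder r₁ ((τ, x) : ℝ × EuclideanSpace ℝ (Fin 3)))),
        Real.sqrt (((τ, x) : ℝ × EuclideanSpace ℝ (Fin 3)).1 - w.1) *
          ‖(α • stPull α 1 0 0 u) w.1 w.2‖ ≤ c := by
      refine (ae_restrict_iff' (isOpen_parabolicCylinder _ _).measurableSet).2 (ae_of_all _ ?_)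
      intro w hw
      rw [mem_parabolicCylinder] at hw
      obtain ⟨⟨hw1, hw2⟩, -⟩ := hw
      dsimp only at hw1 hw2 ⊢
      have ht'T : α * w.1 < T := by
        have h1 : α * w.1 < α * (ν * T) := mul_lt_mul_of_pos_left (lt_of_lt_of_le hw2 hτT) hαpos
        rwa [hανT] at h1
      have ht'I : tI' < α * w.1 := by
        have h1 : α * (ν * tI') < α * w.1 := mul_lt_mul_of_pos_left (by linarith) hαpos
        rwa [← mul_assoc, hαν, one_mul] at h1
      have hTt' : 0 < T - α * w.1 := by linarith
      have hu := hrate (α * w.1) ⟨ht'I, ht'T⟩ (0 + (1 : ℝ) • w.2)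
      rw [smul_stPull_apply, zero_add, norm_smul, Real.norm_of_nonneg hαpos.le]
      have hs0 : 0 < Real.sqrt (T - α * w.1) := Real.sqrt_pos.2 hTt'
      have hu' : Real.sqrt (T - α * w.1) * ‖u (α * w.1) (0 + (1 : ℝ) • w.2)‖ ≤ B := by
        have := mul_le_mul_of_nonneg_left hu hs0.le
        rwa [mul_div_cancel₀ _ hs0.ne'] at this
      have hsqrt : Real.sqrt (τ - w.1) ≤ Real.sqrt ν * Real.sqrt (T - α * w.1) := by
        rw [← Real.sqrt_mul hν.le]
        refine Real.sqrt_le_sqrt ?_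
        have e2 : ν * (T - α * w.1) = ν * T - w.1 := by rw [mul_sub, ← mul_assoc, hνα, one_mul]
        rw [e2]; linarith
      calc Real.sqrt (τ - w.1) * (α * ‖u (α * w.1) (0 + (1 : ℝ) • w.2)‖)
          ≤ Real.sqrt ν * Real.sqrt (T - α * w.1) * (α * ‖u (α * w.1) (0 + (1 : ℝ) • w.2)‖) :=
            mul_le_mul_of_nonneg_right hsqrt (by positivity)
        _ = α * Real.sqrt ν * (Real.sqrt (T - α * w.1) * ‖u (α * w.1) (0 + (1 : ℝ) • w.2)‖) := by ring
        _ ≤ α * Real.sqrt ν * B := mul_le_mul_of_nonneg_left hu' (by positivity)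
        _ = c := by rw [hc]
    exact hKS hsw hGv hr₁pos hzsub ((hCtop).trans (ENNReal.coe_toNNReal hC₀top).symm.le)
      ((hDtop).trans (ENNReal.coe_toNNReal hD₀top).symm.le) hrateV
  -- ### the constants of the claim
  set cν : ℝ := max 1 (Real.sqrt ν) with hcν
  have hcν1 : 1 ≤ cν := le_max_left _ _
  have hcνpos : 0 < cν := lt_of_lt_of_le one_pos hcν1
  have hcνsq : 1 ≤ α * cν ^ 2 := by
    have h1 : ν ≤ cν ^ 2 := by
      have h := pow_le_pow_left₀ (Real.sqrt_nonneg ν) (le_max_right 1 (Real.sqrt ν)) 2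
      rwa [Real.sq_sqrt hν.le] at h
    calc (1 : ℝ) = α * ν := hαν.symm
      _ ≤ α * cν ^ 2 := mul_le_mul_of_nonneg_left h1 hαpos.le
  set tstar : ℝ := tI' + α * r₁ ^ 2 with htstar
  have htstarT : tstar < T := by
    have h1 : α * r₁ ^ 2 ≤ α * (ν * (T - tI') / 4) := mul_le_mul_of_nonneg_left hr₁sq hαpos.le
    have e : α * (ν * (T - tI') / 4) = (T - tI') / 4 := by
      rw [mul_div_assoc', ← mul_assoc, hαν, one_mul]
    rw [htstar]; linarith [e ▸ h1]
  have hνtstar : ν * tstar = ν * tI' + r₁ ^ 2 := by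
    rw [htstar, mul_add, ← mul_assoc, hνα, one_mul]
  set M : ℝ := ν ^ 2 * (KS : ℝ) + ν * (KS : ℝ) * cν + 1 with hM
  have hKS0 : 0 ≤ (KS : ℝ) := KS.2
  have hMpos : 0 < M := by rw [hM]; positivity
  refine ⟨M, r₁ / (4 * cν), tstar, hMpos, by positivity, htstarT, by rw [htstar]; positivity, ?_, ?_⟩
  · -- ### (A): the energy of balls at late times
    intro s₀ hs₀ x R hR
    have hRr₁ : R < r₁ / 2 := by
      have h1 : r₁ / (4 * cν) ≤ r₁ / 4 :=
        div_le_div_of_nonneg_left hr₁pos.le (by norm_num) (by nlinarith [hcν1])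
      linarith [hR.2]
    set τ : ℝ := min (ν * T) (ν * s₀ + R ^ 2 / 2) with hτ
    have hτT : τ ≤ ν * T := min_le_left _ _
    have hτs : τ ≤ ν * s₀ + R ^ 2 / 2 := min_le_right _ _
    have hτI : ν * tI' + r₁ ^ 2 ≤ τ := by
      refine le_min ?_ ?_
      · have e : ν * tI' + ν * (T - tI') = ν * T := by ring
        linarith [hr₁sq, hνTI]
      · have : ν * tstar ≤ ν * s₀ := mul_le_mul_of_nonneg_left hs₀.1 hν.le
        have hR2 : 0 ≤ R ^ 2 := sq_nonneg R
        linarith [hνtstar]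
    have hs₀τ : ν * s₀ < τ :=
      lt_min (mul_lt_mul_of_pos_left hs₀.2 hν) (by have := pow_pos hR.1 2; linarith)
    have hR0 : ENNReal.ofReal R ≠ 0 := (ENNReal.ofReal_pos.2 hR.1).ne'
    set z : ℝ × EuclideanSpace ℝ (Fin 3) := (τ, x) with hz
    have hS := hKz τ x hτI hτT R ⟨hR.1, hRr₁⟩
    have hAR : cknAEss R z (α • stPull α 1 0 0 u) ≤ KS :=
      le_trans (le_trans (le_trans le_self_add le_self_add) le_self_add) hS
    -- a.e. slice bound for `u` on `(α(τ - R²), ατ)`, then every time, in particular `s₀`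
    have hunzoom : ∀ (s : ℝ) (y : EuclideanSpace ℝ (Fin 3)),
        ‖ν‖ₑ ^ 2 * ‖(α • stPull α 1 0 0 u) s y‖ₑ ^ 2 = ‖u (α * s) y‖ₑ ^ 2 := by
      intro s y
      rw [← mul_pow, ← enorm_smul, smul_stPull_apply, smul_smul, hνα, one_smul, zero_add, zero_add,
        one_smul]
    have hν2 : ‖ν‖ₑ ^ 2 = ENNReal.ofReal (ν ^ 2) := by
      rw [Real.enorm_eq_ofReal hν.le, ENNReal.ofReal_pow hν.le]
    have hae : ∀ᵐ s ∂(volume.restrict (Ioo (τ - R ^ 2) τ)),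
        ∫⁻ y in ball x R, ‖u (α * s) y‖ₑ ^ 2 ≤ ENNReal.ofReal (ν ^ 2) * (ENNReal.ofReal R * KS) := by
      have h1 := ENNReal.ae_le_essSup (μ := volume.restrict (Ioo (z.1 - R ^ 2) z.1))
        (fun t => (ENNReal.ofReal R)⁻¹ * ∫⁻ y in ball z.2 R, ‖(α • stPull α 1 0 0 u) t y‖ₑ ^ 2)
      have h1' : ∀ᵐ s ∂(volume.restrict (Ioo (z.1 - R ^ 2) z.1)),
          (ENNReal.ofReal R)⁻¹ * ∫⁻ y in ball z.2 R, ‖(α • stPull α 1 0 0 u) s y‖ₑ ^ 2 ≤ KS :=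
        h1.mono fun s hs => hs.trans hAR
      simp only [hz] at h1'
      filter_upwards [h1'] with s hs
      have hI : ∫⁻ y in ball x R, ‖(α • stPull α 1 0 0 u) s y‖ₑ ^ 2 ≤ ENNReal.ofReal R * KS := by
        calc ∫⁻ y in ball x R, ‖(α • stPull α 1 0 0 u) s y‖ₑ ^ 2
            = ENNReal.ofReal R * ((ENNReal.ofReal R)⁻¹ *
                ∫⁻ y in ball x R, ‖(α • stPull α 1 0 0 u) s y‖ₑ ^ 2) := by
              rw [← mul_assoc, ENNReal.mul_inv_cancel hR0 ENNReal.ofReal_ne_top, one_mul]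
          _ ≤ ENNReal.ofReal R * KS := mul_le_mul' le_rfl hs
      calc ∫⁻ y in ball x R, ‖u (α * s) y‖ₑ ^ 2
          = ∫⁻ y in ball x R, ‖ν‖ₑ ^ 2 * ‖(α • stPull α 1 0 0 u) s y‖ₑ ^ 2 :=
            lintegral_congr fun y => (hunzoom s y).symm
        _ = ‖ν‖ₑ ^ 2 * ∫⁻ y in ball x R, ‖(α • stPull α 1 0 0 u) s y‖ₑ ^ 2 :=
            lintegral_const_mul' _ _ (by simp)
        _ ≤ ENNReal.ofReal (ν ^ 2) * (ENNReal.ofReal R * KS) := by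
            rw [hν2]; exact mul_le_mul' le_rfl hI
    have e1 : (0 : ℝ) + ν * (α * (τ - R ^ 2)) = τ - R ^ 2 := by rw [← mul_assoc, hνα, one_mul, zero_add]
    have e2 : (0 : ℝ) + ν * (α * τ) = τ := by rw [← mul_assoc, hνα, one_mul, zero_add]
    have hae' : ∀ᵐ s ∂(volume.restrict (Ioo (0 + ν * (α * (τ - R ^ 2))) (0 + ν * (α * τ)))),
        ∫⁻ y in ball x R, ‖u (α * s) y‖ₑ ^ 2 ≤ ENNReal.ofReal (ν ^ 2) * (ENNReal.ofReal R * KS) := by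
      rw [e1, e2]; exact hae
    have hphys := ae_restrict_Ioo_comp_time_affine hν 0 (α * (τ - R ^ 2)) (α * τ) hae'
    have hphys' : ∀ᵐ t ∂(volume.restrict (Ioo (α * (τ - R ^ 2)) (α * τ))),
        ∫⁻ y in ball x R, ‖u t y‖ₑ ^ 2 ≤ ENNReal.ofReal (ν ^ 2) * (ENNReal.ofReal R * KS) := by
      filter_upwards [hphys] with t ht
      have e3 : α * (0 + ν * t) = t := by rw [zero_add, ← mul_assoc, hαν, one_mul]
      rwa [e3] at ht
    have hsub : Ioo (α * (τ - R ^ 2)) (α * τ) ⊆ Ico 0 T := by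
      intro t ht
      have hR2τ : R ^ 2 ≤ τ := by
        have h1 : R ≤ r₁ := by linarith [hr₁pos]
        have h2 := pow_le_pow_left₀ hR.1.le h1 2
        linarith [hτI, mul_nonneg hν.le htI'0]
      have h0 : 0 ≤ α * (τ - R ^ 2) := mul_nonneg hαpos.le (sub_nonneg.2 hR2τ)
      have h1 : α * τ ≤ α * (ν * T) := mul_le_mul_of_nonneg_left hτT hαpos.le
      rw [hανT] at h1
      exact ⟨h0.trans ht.1.le, lt_of_lt_of_le ht.2 h1⟩
    have hs₀mem : s₀ ∈ Ioo (α * (τ - R ^ 2)) (α * τ) := by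
      constructor
      · have hR2 : 0 < R ^ 2 := pow_pos hR.1 2
        have h1 : α * (τ - R ^ 2) < α * (ν * s₀) :=
          mul_lt_mul_of_pos_left (by linarith [hτs]) hαpos
        rwa [← mul_assoc, hαν, one_mul] at h1
      · have h1 : α * (ν * s₀) < α * τ := mul_lt_mul_of_pos_left hs₀τ hαpos
        rwa [← mul_assoc, hαν, one_mul] at h1
    have hfin := setLIntegral_ball_sq_le_of_ae hcont hsub hphys' s₀ hs₀mem
    refine hfin.trans ?_
    rw [← ENNReal.ofReal_coe_nnreal, ← ENNReal.ofReal_mul hR.1.le, ← ENNReal.ofReal_mul (sq_nonneg _)]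
    refine ENNReal.ofReal_le_ofReal ?_
    have h3 : 0 ≤ ν * (KS : ℝ) * cν := by positivity
    have e : ν ^ 2 * (R * (KS : ℝ)) = (ν ^ 2 * (KS : ℝ)) * R := by ring
    rw [hM, e]
    exact mul_le_mul_of_nonneg_right (by linarith) hR.1.le
  · -- ### (E): the dissipation of final cylinders at late final times
    intro b hb x R hR
    set ρ : ℝ := R * cν with hρ
    have hρpos : 0 < ρ := mul_pos hR.1 hcνpos
    have hρR : R ≤ ρ := by rw [hρ]; exact le_mul_of_one_le_right hR.1.le hcν1
    have hρr₁ : ρ < r₁ / 2 := by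
      have hcν0 : cν ≠ 0 := hcνpos.ne'
      have h1 : R * cν ≤ r₁ / (4 * cν) * cν := mul_le_mul_of_nonneg_right hR.2 hcνpos.le
      rw [div_mul_eq_mul_div, mul_div_mul_right _ _ hcν0] at h1
      rw [hρ]; linarith [hr₁pos]
    have hτI : ν * tI' + r₁ ^ 2 ≤ ν * b := by
      have : ν * tstar ≤ ν * b := mul_le_mul_of_nonneg_left hb.1.le hν.le
      linarith [hνtstar]
    have hτT : ν * b ≤ ν * T := mul_le_mul_of_nonneg_left hb.2 hν.le
    have hS := hKz (ν * b) x hτI hτT ρ ⟨hρpos, hρr₁⟩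
    have hE : cknE ρ ((ν * b, x) : ℝ × EuclideanSpace ℝ (Fin 3))
        ((α * 1) • stPull α 1 0 0 fun t x => fderiv ℝ (u t) x) ≤ KS :=
      le_trans (le_trans le_add_self le_self_add) (le_trans le_self_add hS)
    -- unfold `E(ρ) ≤ KS` into a bound for the rescaled cylinder integral
    have hρ0 : ENNReal.ofReal ρ ≠ 0 := (ENNReal.ofReal_pos.2 hρpos).ne'
    have hcylint : ∫⁻ w in parabolicCylinder ρ ((ν * b, x) : ℝ × EuclideanSpace ℝ (Fin 3)),
        ENNReal.ofReal (frobeniusNormSq (((α * 1) • stPull α 1 0 0 fun t x => fderiv ℝ (u t) x) w.1 w.2))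
          ≤ ENNReal.ofReal ρ * KS := by
      unfold cknE at hE
      calc _ = ENNReal.ofReal ρ * ((ENNReal.ofReal ρ)⁻¹ * ∫⁻ w in parabolicCylinder ρ
              ((ν * b, x) : ℝ × EuclideanSpace ℝ (Fin 3)),
              ENNReal.ofReal (frobeniusNormSq
                (((α * 1) • stPull α 1 0 0 fun t x => fderiv ℝ (u t) x) w.1 w.2))) := by
            rw [← mul_assoc, ENNReal.mul_inv_cancel hρ0 ENNReal.ofReal_ne_top, one_mul]
        _ ≤ ENNReal.ofReal ρ * KS := mul_le_mul' le_rfl hE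
    rw [← hpre (ν * b) ρ x, setLIntegral_frobeniusNormSq_stRescale hαpos one_pos 0 0 (α * 1)
      (fun t x => fderiv ℝ (u t) x) _] at hcylint
    simp only [finrank_euclideanSpace_fin, one_pow, mul_one] at hcylint
    -- the physical cylinder `(b − R², b) × B(x, R)` lies in `(α(νb − ρ²), ανb) × B(x, ρ)`
    have hανb : α * (ν * b) = b := by rw [← mul_assoc, hαν, one_mul]
    have hsubset : Ioo (b - R ^ 2) b ×ˢ ball x R ⊆ Ioo (α * (ν * b - ρ ^ 2)) (α * (ν * b)) ×ˢ ball x ρ := by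
      refine prod_mono (Ioo_subset_Ioo ?_ hανb.symm.le) (ball_subset_ball hρR)
      have e : α * (ν * b - ρ ^ 2) = b - (α * cν ^ 2) * R ^ 2 := by rw [mul_sub, hανb, hρ]; ring
      rw [e]
      have : 1 * R ^ 2 ≤ (α * cν ^ 2) * R ^ 2 := mul_le_mul_of_nonneg_right hcνsq (sq_nonneg _)
      linarith
    have hcoef : ENNReal.ofReal (α ^ 2) * ENNReal.ofReal α⁻¹ = ENNReal.ofReal α := by
      rw [← ENNReal.ofReal_mul (sq_nonneg _), pow_two, mul_assoc, mul_inv_cancel₀ hαpos.ne', mul_one]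
    rw [hcoef] at hcylint
    have hα0 : ENNReal.ofReal α ≠ 0 := (ENNReal.ofReal_pos.2 hαpos).ne'
    have hphysE : ∫⁻ w in Ioo (α * (ν * b - ρ ^ 2)) (α * (ν * b)) ×ˢ ball x ρ,
        ENNReal.ofReal (frobeniusNormSq (fderiv ℝ (u w.1) w.2)) ≤ ENNReal.ofReal ν * (ENNReal.ofReal ρ * KS) := by
      have h1 := mul_le_mul' (le_refl (ENNReal.ofReal ν)) hcylint
      rwa [← mul_assoc, ← ENNReal.ofReal_mul hν.le, hνα, ENNReal.ofReal_one, one_mul] at h1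
    refine ((lintegral_mono_set hsubset).trans hphysE).trans ?_
    rw [← ENNReal.ofReal_coe_nnreal, ← ENNReal.ofReal_mul hρpos.le, ← ENNReal.ofReal_mul hν.le]
    refine ENNReal.ofReal_le_ofReal ?_
    have h3 : 0 ≤ ν ^ 2 * (KS : ℝ) := by positivity
    have e : ν * (ρ * (KS : ℝ)) = (ν * (KS : ℝ) * cν) * R := by rw [hρ]; ring
    rw [hM, e]
    exact mul_le_mul_of_nonneg_right (by linarith) hR.1.le

end Summit.NavierStokesRegularity.NavierStokesRegularity.Theorems.CountQuarterLaw

end
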